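import Mathlib
import Summits.Ventures.HodgeRepro2.T5DegreeOnePadic

/-!
# T5DegreeOneCompletion — the completion of `K` at a degree-one prime IS `ℚ_[p]`

Tier-5 kernel support (seat p7), file (4) of the chain behind route/T5-LEAN-p7.md §22 (fourth
addendum): THE COMPLETION READING «the completion of `F` at a degree-one prime `𝔭` is `ℚ_p`» as a
theorem. With `toPadic : K →+* ℚ_[p]` and the equality of valuations of `T5DegreeOnePadic`,
the map `toPadic`, read on the type synonym `WithVal (w.valuation K)` carrying the `w`-adic
topology, is a uniform inducing map with dense range (`isUniformInducing_toPadicWithVal`,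
`isDenseInducing_toPadicWithVal`; the proof is the template of Mathlib's
`Padic.isUniformInducing_cast_withVal`), hence extends to
* `withValRingEquiv : (w.valuation K).Completion ≃+* ℚ_[p]` and
  `withValUniformEquiv : (w.valuation K).Completion ≃ᵤ ℚ_[p]` (the template of Mathlib's
  `Padic.withValRingEquiv` / `Padic.withValUniformEquiv`), and, transported along Mathlib's
  `adicCompletion.equiv` / `adicCompletion.uniformEquiv`,
* `adicCompletionRingEquiv : w.adicCompletion K ≃+* ℚ_[p]` and
  `adicCompletionUniformEquiv : w.adicCompletion K ≃ᵤ ℚ_[p]`, restricting to `toPadic` on `K`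
  (`adicCompletionRingEquiv_coe`) and to `toPadicInt` on `R` (`adicCompletionRingEquiv_algebraMap`).

Setting: `R` a Dedekind domain with fraction field `K`, `w : HeightOneSpectrum R`, `p` a rational
prime with `(p : R) ∈ w.asIdeal`, `(p : R) ∉ w.asIdeal ^ 2` (`e = 1`) and `ℤ → R ⧸ w.asIdeal`
surjective (`f = 1`). Mathlib only beyond the chain. Nothing about the cell's datum is declared here;
the instantiation at a number field is file (5).
-/

namespace Summit.Ventures.HodgeRepro2.T5DegreeOneCompletion

open Ideal IsDedekindDomain WithZero UniformSpace
open Summit.Ventures.HodgeRepro2.T5DegreeOneQuotient Summit.Ventures.HodgeRepro2.T5DegreeOnePadicInt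
  Summit.Ventures.HodgeRepro2.T5DegreeOnePadic

variable {R : Type*} [CommRing R] [IsDedekindDomain R] {K : Type*} [Field K] [Algebra R K]
  [IsFractionRing R K] (w : HeightOneSpectrum R) {p : ℕ} [hp : Fact p.Prime]
  (hpP : (p : R) ∈ w.asIdeal) (hpP2 : (p : R) ∉ w.asIdeal ^ 2)
  (hsurj : ∀ x : R, ∃ a : ℤ, x - a ∈ w.asIdeal)
include hpP hpP2 hsurj

/-- `toPadic` read on the type synonym `WithVal (w.valuation K)` (which carries the `w`-adic
uniform structure). -/
noncomputable def toPadicWithVal : WithVal (w.valuation K) →+* ℚ_[p] :=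
  (toPadic w hpP hpP2 hsurj).comp (WithVal.equiv (w.valuation K)).toRingHom

/-- `toPadicWithVal x = toPadic (WithVal.equiv _ x)`. -/
theorem toPadicWithVal_apply (x : WithVal (w.valuation K)) :
    toPadicWithVal w hpP hpP2 hsurj x = toPadic w hpP hpP2 hsurj (WithVal.equiv (w.valuation K) x) :=
  rfl

/-- The range of `toPadicWithVal` is the range of `toPadic`, hence dense. -/
theorem denseRange_toPadicWithVal : DenseRange (toPadicWithVal w hpP hpP2 hsurj (K := K)) := by
  have h : Set.range (toPadicWithVal w hpP hpP2 hsurj (K := K)) =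
      Set.range (toPadic w hpP hpP2 hsurj (K := K)) := by
    ext y
    constructor
    · rintro ⟨x, rfl⟩
      exact ⟨WithVal.equiv _ x, rfl⟩
    · rintro ⟨x, rfl⟩
      exact ⟨(WithVal.equiv (w.valuation K)).symm x, by
        rw [toPadicWithVal_apply, RingEquiv.apply_symm_apply]⟩
  show Dense _
  rw [h]
  exact denseRange_toPadic w hpP hpP2 hsurj

open MonoidWithZeroHom.ValueGroup₀ in
/-- `toPadicWithVal` is a uniform inducing map: the `w`-adic uniformity of `K` is the pull-back of
the `p`-adic uniformity of `ℚ_[p]` (both have the bases of balls `v(y - x) < exp (-n)`, resp.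
`‖y - x‖ ≤ p⁻ⁿ`, matched by `valuation_lt_exp_iff` / `valuation_le_exp_iff`). -/
theorem isUniformInducing_toPadicWithVal :
    IsUniformInducing (toPadicWithVal w hpP hpP2 hsurj (K := K)) := by
  have hp0 : (0 : ℝ) < (p : ℝ)⁻¹ := inv_pos.mpr (by exact_mod_cast hp.out.pos)
  have hp1 : (p : ℝ)⁻¹ < 1 := inv_lt_one_of_one_lt₀ (by exact_mod_cast hp.out.one_lt)
  have h1p : (1 : ℝ) < p := by exact_mod_cast hp.out.one_lt
  rw [Filter.HasBasis.isUniformInducing_iff (Valued.hasBasis_uniformity _ _)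
    (Metric.uniformity_basis_dist_le_pow hp0 hp1)]
  simp only [Set.mem_setOf_eq, dist_eq_norm_sub, inv_pow, true_and, forall_const]
  constructor
  · intro n
    set π : WithVal (w.valuation K) := WithVal.toVal _ (algebraMap R K ((p : R) ^ n)) with hπ
    have hπv : Valued.v π = exp (-(n : ℤ)) := by
      rw [hπ, WithVal.valued_toVal, HeightOneSpectrum.valuation_of_algebraMap]
      exact intValuation_natCast_pow w.ne_bot hpP hpP2 n
    refine ⟨Units.mk0 (Valued.v.restrict π) ?_, fun x y h => ?_⟩
    · rw [Ne, Valuation.restrict_eq_zero_iff, hπv]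
      exact exp_ne_zero
    · rw [Valuation.map_sub_swap, Units.val_mk0, Valuation.restrict_lt_iff, hπv,
        ← WithVal.val_apply_equiv, map_sub, valuation_lt_exp_iff w hpP hpP2 hsurj] at h
      rw [toPadicWithVal_apply, toPadicWithVal_apply, ← map_sub, ← zpow_natCast, ← zpow_neg]
      exact h.le
  · intro γ
    have hγ : embedding γ.1 ≠ 0 := embedding_unit_ne_zero γ
    refine ⟨(-log (embedding γ.1)).toNat + 1, fun x y h => ?_⟩
    rw [Valuation.map_sub_swap, Valuation.restrict_lt_iff_lt_embedding, ← WithVal.val_apply_equiv,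
      map_sub, ← exp_log hγ, valuation_lt_exp_iff w hpP hpP2 hsurj]
    rw [toPadicWithVal_apply, toPadicWithVal_apply, ← map_sub, ← zpow_natCast, ← zpow_neg] at h
    refine lt_of_le_of_lt h (zpow_lt_zpow_right₀ h1p ?_)
    have := Int.self_le_toNat (-log (embedding γ.1))
    push_cast
    omega

/-- `toPadicWithVal` is a dense inducing map. -/
theorem isDenseInducing_toPadicWithVal :
    IsDenseInducing (toPadicWithVal w hpP hpP2 hsurj (K := K)) :=
  (isUniformInducing_toPadicWithVal w hpP hpP2 hsurj (K := K)).isDenseInducing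
    (denseRange_toPadicWithVal w hpP hpP2 hsurj (K := K))

open UniformSpace.Completion in
/-- THE COMPLETION OF `K` AT `w` IS `ℚ_[p]` (as rings): the uniform-space completion
`(w.valuation K).Completion` of `K` for the `w`-adic uniformity is isomorphic to `ℚ_[p]`, by
extension of `toPadicWithVal` (Mathlib's `Completion.extensionHom`), with inverse the extension of
the coercion `K → (w.valuation K).Completion` along the dense inducing map `toPadicWithVal`. -/
noncomputable def withValRingEquiv : (w.valuation K).Completion ≃+* ℚ_[p] where
  toFun := extensionHom (toPadicWithVal w hpP hpP2 hsurj (K := K))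
    (isUniformInducing_toPadicWithVal w hpP hpP2 hsurj (K := K)).uniformContinuous.continuous
  invFun := (isDenseInducing_toPadicWithVal w hpP hpP2 hsurj (K := K)).extend
    ((↑) : WithVal (w.valuation K) → (w.valuation K).Completion)
  left_inv y := by
    induction y using induction_on
    · refine isClosed_eq ?_ continuous_id
      exact (uniformContinuous_uniformly_extend (isUniformInducing_toPadicWithVal w hpP hpP2 hsurj (K := K))
        (isDenseInducing_toPadicWithVal w hpP hpP2 hsurj (K := K)).dense
        (uniformContinuous_coe _)).continuous.comp continuous_extension
    · rw [extensionHom_coe]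
      exact IsDenseInducing.extend_eq _ (continuous_coe _) _
  right_inv y := by
    induction y using isClosed_property (denseRange_toPadicWithVal w hpP hpP2 hsurj (K := K))
    · refine isClosed_eq ?_ continuous_id
      exact continuous_extension.comp (uniformContinuous_uniformly_extend
        (isUniformInducing_toPadicWithVal w hpP hpP2 hsurj (K := K))
        (isDenseInducing_toPadicWithVal w hpP hpP2 hsurj (K := K)).dense (uniformContinuous_coe _)).continuous
    · rw [IsDenseInducing.extend_eq _ (continuous_coe _) _, extensionHom_coe]
  map_mul' := map_mul _
  map_add' := map_add _

/-- `withValRingEquiv` restricts to `toPadic` on `K`. -/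
theorem withValRingEquiv_coe (x : WithVal (w.valuation K)) :
    withValRingEquiv w hpP hpP2 hsurj (K := K) (x : (w.valuation K).Completion) =
      toPadic w hpP hpP2 hsurj (WithVal.equiv (w.valuation K) x) :=
  UniformSpace.Completion.extensionHom_coe (toPadicWithVal w hpP hpP2 hsurj (K := K))
    (isUniformInducing_toPadicWithVal w hpP hpP2 hsurj (K := K)).uniformContinuous.continuous x

/-- `withValRingEquiv` as a uniform-space isomorphism. -/
noncomputable def withValUniformEquiv : (w.valuation K).Completion ≃ᵤ ℚ_[p] :=
  UniformEquiv.symm <|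
    (withValRingEquiv w hpP hpP2 hsurj (K := K)).symm.toUniformEquivOfIsUniformInducing <|
      (isDenseInducing_toPadicWithVal w hpP hpP2 hsurj (K := K)).isUniformInducing_extend
        (isUniformInducing_toPadicWithVal w hpP hpP2 hsurj (K := K))
        (UniformSpace.Completion.isUniformInducing_coe _)

/-- The uniform-space isomorphism and the ring isomorphism are the same map. -/
theorem coe_withValUniformEquiv :
    ⇑(withValUniformEquiv w hpP hpP2 hsurj (K := K)) = ⇑(withValRingEquiv w hpP hpP2 hsurj (K := K)) := rfl

/-- THE COMPLETION OF `K` AT `w` IS `ℚ_[p]`, on Mathlib's `w.adicCompletion K`. -/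
noncomputable def adicCompletionRingEquiv : w.adicCompletion K ≃+* ℚ_[p] :=
  (HeightOneSpectrum.adicCompletion.equiv K w).trans (withValRingEquiv w hpP hpP2 hsurj (K := K))

/-- `adicCompletionRingEquiv` restricts to `toPadic` on `K`. -/
theorem adicCompletionRingEquiv_coe (k : K) :
    adicCompletionRingEquiv w hpP hpP2 hsurj (K := K) (k : w.adicCompletion K) = toPadic w hpP hpP2 hsurj k := by
  rw [adicCompletionRingEquiv, RingEquiv.trans_apply, HeightOneSpectrum.adicCompletion.equiv_apply,
    HeightOneSpectrum.adicCompletion.coe_toCompletion]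
  exact withValRingEquiv_coe w hpP hpP2 hsurj (WithVal.toVal _ k)

/-- `adicCompletionRingEquiv` restricts to `toPadicInt` on `R`. -/
theorem adicCompletionRingEquiv_algebraMap (r : R) :
    adicCompletionRingEquiv w hpP hpP2 hsurj (K := K) (algebraMap R (w.adicCompletion K) r) =
      (toPadicInt w.ne_bot hpP hpP2 hsurj r : ℚ_[p]) := by
  rw [← toPadic_algebraMap w hpP hpP2 hsurj (K := K), ← adicCompletionRingEquiv_coe]
  rfl

/-- `adicCompletionRingEquiv` as a uniform-space isomorphism: `w.adicCompletion K ≃ᵤ ℚ_[p]`. -/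
noncomputable def adicCompletionUniformEquiv : w.adicCompletion K ≃ᵤ ℚ_[p] :=
  (HeightOneSpectrum.adicCompletion.uniformEquiv K w).trans (withValUniformEquiv w hpP hpP2 hsurj (K := K))

/-- The uniform-space isomorphism and the ring isomorphism of `w.adicCompletion K` with `ℚ_[p]` are
the same map. -/
theorem coe_adicCompletionUniformEquiv :
    ⇑(adicCompletionUniformEquiv w hpP hpP2 hsurj (K := K)) = ⇑(adicCompletionRingEquiv w hpP hpP2 hsurj (K := K)) :=
  rfl

/-- `adicCompletionRingEquiv` is continuous. -/
theorem continuous_adicCompletionRingEquiv :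
    Continuous (adicCompletionRingEquiv w hpP hpP2 hsurj (K := K)) := by
  rw [← coe_adicCompletionUniformEquiv]
  exact (adicCompletionUniformEquiv w hpP hpP2 hsurj (K := K)).continuous

/-- The inverse of `adicCompletionRingEquiv` is continuous. -/
theorem continuous_adicCompletionRingEquiv_symm :
    Continuous (adicCompletionRingEquiv w hpP hpP2 hsurj (K := K)).symm :=
  (adicCompletionUniformEquiv w hpP hpP2 hsurj (K := K)).symm.continuous

end Summit.Ventures.HodgeRepro2.T5DegreeOneCompletion
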